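import Summits.RiemannHypothesis.RiemannHypothesis.Theorems.Splittings.LiExtremalLayer
import Summits.RiemannHypothesis.RiemannHypothesis.Theorems.Splittings.LiOneSidedCriteria
import HarnessLib

/-!
# The FLOOR-RATE LAW for the Keiper–Li coefficients (SketchG9 §§1–4)

Cell rh-split, seat rh-split-li-bridge g9 (brief sha16 f79c5f09d8bcb036), card `run/shared/lean/pub/rh-split/cards/SPLIT-li-bridge.md` §16;
kernel source `HOME/rh-split-li-bridge/SketchG9.lean` sha16 6b07bb859a043295 (409 l, farm rc 0, std axioms), cut by the seat at the scratch's
section boundaries (l. 60–299 / l. 300–406), decl text byte-verbatim; deltas = namespace `RhSplit.LiBridgeG9` ↦ `…Theorems.Splittings.LiFloorRateLaw`,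
imports, module docstrings.  Tree inputs only (cited, not re-derived): `LiExtremalLayer.li_two_signs_of_not_rh` / `exists_offline_zero` /
`normZ_lt_one` / `one_sub_inv_ne_zero` / `eventually_pos_of_rh` / `liPos_syndetic` (gen-5 carve), `LiOneSidedCriteria.liSubexpUpper_of_rh`
(gen-4 carve), `li_criterion_holds`, `LiIndexSets.re_eq_half_of_abs_im_le`, `BombieriLagarias.norm_inv_one_sub_inv_le_one_iff`,
`riemannHypothesis_of_keiperLiCoeff_bddBelow`, `riemannHypothesisUpTo_1000` (standard axioms).

THE LAW (this file).  Write `z(ρ) = 1 − 1/ρ` for a non-trivial zero `ρ` (`|z(ρ)| < 1 ⟺ Re ρ > ½`, `|z(ρ)| = 1 ⟺ Re ρ = ½`,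
`λ_n = keiperLiCoeff n`).  For every `0 < r ≤ 1`:

  `(∃ C, ∀ n ≥ 1, λ_n ≥ −C·r^{−n})  ⟺  (∀ ρ, |z(ρ)| ≥ r)`                      (`liFloorRate_iff`)

and for `0 < r < 1` the same with the CEILING `λ_n ≤ C·r^{−n}` (`liCeilRate_iff`) or the two-sided envelope `|λ_n| ≤ C·r^{−n}`
(`liEnvelopeRate_iff`); `RiemannHypothesis ⟺ ∀ ρ, 1 ≤ |z(ρ)|` (`rh_iff_forall_one_le_normZ`); `RiemannHypothesisUpTo T ⟹ ∀ ρ,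
T/√(1+T²) ≤ |z(ρ)|` (`forall_le_normZ_of_rhUpTo`, from the geometry `normZ_sq_ge : 0 < Re ρ < 1 → (Im ρ)²/(1+(Im ρ)²) ≤ |z(ρ)|²`).
The right-hand side of the law says: `ζ` has no zero in the open Apollonius disc `D_r = {s : |s − 1| < r|s|}` (centre `1/(1−r²)`,
radius `r/(1−r²)`, real diameter `(1/(1+r), 1/(1−r))`), a BOUNDED region inside `{Re s > ½}` meeting the critical strip only at
heights `|Im s| < r/√(1−r²)` — a verified-height-type (FIN-class) statement for each fixed `r < 1`, and RH at `r = 1`.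
§1 geometry of `|z(ρ)|`; §2 two analytic lemmas (`patch_upper`: finitely many indices are absorbed into the constant of an
exponential upper bound; `eventually_lt_of_rate_gap`: no room between two rates); §3 the two halves (`forall_le_normZ_of_oneSided`:
a one-sided envelope at rate `r` excludes zeros with `|z(ρ)| < r`, via the two-signed bounded-gap oscillation `li_two_signs_of_not_rh`
and NOT via Cauchy–Hadamard, which sees only `|λ_n|`; `liEnvelope_of_forall_le_normZ_of_not_rh`, `liCeilRate_of_rh`); §4 the law
and its ceiling / two-sided forms.  The ends of the scale (`r = 1` is RH, every `r < 1` follows from a verified height, nothing in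
between; the unconditional envelope) are in `LiFloorRateLawEnds`.

Prior art (print): the disc `D_r` and the dictionary «zeros with |Im ρ| ≤ T on the line ⟹ all zeros in the region `|1 − 1/ρ| ≥ r`,
`1/r = √(1+T⁻²)`» are Brown 2005 (JNT 111, §1.3), with effective finite-`n` one-directional forms in Palojärvi 2020 (arXiv:1807.01506,
Thms 1.1/1.2); the two-sided direction «no zero with |z(ρ)| ≤ r ⟹ λ_n = o(r^{−n})» is Voros 2006 (DA) (tree `Voros2006_eqDA_holds`),
quantitatively the tree's `LiTheory.liAsymptoticLawAllRange_holds`; the `∀ ε` floor criterion is Bombieri–Lagarias 1999 Thm 1; the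
radius-of-convergence reading of Keiper's series is Keiper 1992 (Math. Comp. 58).  Typed here and not found in print: the ONE-SIDED
envelopes (floor alone, ceiling alone) at a FIXED rate are each EQUIVALENT to the zero-free disc, with the exact rate, all `n`, no `ε`,
boundary case (a zero on the circle `|z| = r`) included.

HONEST LABEL: «SPLITTING SEARCH over kernel-typed RH-EQUIVALENCES; a splitting A ∧ B ⟹ RH is CONDITIONAL bookkeeping unless A and B are
both proved; nothing here bears on the truth of RH.»  Every theorem below is RH-FREE (an implication / equivalence between two statements neither of which is asserted); no
RH-equivalence other than the classical `r = 1` reading is claimed; certifies nothing about RH.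
-/

set_option linter.dupNamespace false

noncomputable section

open Complex Filter Topology Finset
open scoped Real ComplexConjugate

namespace Summit.RiemannHypothesis.RiemannHypothesis.Theorems.Splittings.LiFloorRateLaw

open Literature.NumberTheory.LFunctions
open Literature.NumberTheory.DiophantineGeometry
open Summit.RiemannHypothesis.RiemannHypothesis.Theorems.Splittings
open Summit.RiemannHypothesis.RiemannHypothesis.Theorems.Splittings.LiIndexSets
open Summit.RiemannHypothesis.RiemannHypothesis.Theorems.Splittings.LiExtremalLayer
open Summit.RiemannHypothesis.RiemannHypothesis.Theorems.Splittings.LiOneSidedCriteria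

/-! ## §1 Geometry of the Keiper–Li modulus `|1 − 1/ρ|` -/

/-- On or left of the critical line the Keiper–Li modulus is `≥ 1`. -/
theorem one_le_normZ_of_re_le_half {ρ : ℂ} (hρ : ρ ∈ ZetaZeros.riemannZetaNontrivialZeros)
    (hre : ρ.re ≤ 1 / 2) : 1 ≤ ‖1 - 1 / ρ‖ := by
  have h1 := ZetaZeros.riemannZetaNontrivialZeros.ne_one hρ
  have h := (BombieriLagarias.norm_inv_one_sub_inv_le_one_iff h1).2 hre
  have hpos : 0 < ‖1 - 1 / ρ‖ := norm_pos_iff.2 (one_sub_inv_ne_zero hρ)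
  by_contra hlt
  rw [not_le] at hlt
  have h2 : 1 < ‖1 - 1 / ρ‖⁻¹ := (one_lt_inv_iff₀).2 ⟨hpos, hlt⟩
  rw [norm_inv] at h
  linarith

/-- Under RH every non-trivial zero is on the line (cf. tree `BombieriFozNoDep.re_eq_half_of_rh`; three-line helper). -/
private theorem re_eq_half_of_rh (hRH : _root_.RiemannHypothesis) {ρ : ℂ}
    (hρ : ρ ∈ ZetaZeros.riemannZetaNontrivialZeros) : ρ.re = 1 / 2 :=
  hRH ρ (ZetaZeros.riemannZetaNontrivialZeros.zeta_eq_zero hρ)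
    (by rintro ⟨k, hk⟩; exact hρ.2 ⟨k, hk.symm⟩) (ZetaZeros.riemannZetaNontrivialZeros.ne_one hρ)

/-- Under RH every Keiper–Li modulus is `≥ 1`. -/
theorem one_le_normZ_of_rh (hRH : _root_.RiemannHypothesis) {ρ : ℂ}
    (hρ : ρ ∈ ZetaZeros.riemannZetaNontrivialZeros) : 1 ≤ ‖1 - 1 / ρ‖ :=
  one_le_normZ_of_re_le_half hρ (re_eq_half_of_rh hRH hρ).le

/-- For `0 < Re ρ < 1`: `|1 − 1/ρ|² ≥ (Im ρ)²/(1 + (Im ρ)²)` (numerator `|ρ−1|² ≥ (Im ρ)²`, denominator `|ρ|² ≤ 1 + (Im ρ)²`). -/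
theorem normZ_sq_ge {ρ : ℂ} (h0 : 0 < ρ.re) (h1 : ρ.re < 1) :
    ρ.im ^ 2 / (1 + ρ.im ^ 2) ≤ ‖1 - 1 / ρ‖ ^ 2 := by
  have hρ0 : ρ ≠ 0 := fun h ↦ by rw [h, Complex.zero_re] at h0; exact lt_irrefl _ h0
  have hz : 1 - 1 / ρ = (ρ - 1) / ρ := by field_simp
  have hden : 0 < ρ.re * ρ.re + ρ.im * ρ.im := add_pos_of_pos_of_nonneg (mul_pos h0 h0) (mul_self_nonneg _)
  rw [hz, norm_div, div_pow, Complex.sq_norm, Complex.sq_norm, Complex.normSq_apply, Complex.normSq_apply]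
  simp only [sub_re, one_re, sub_im, one_im, sub_zero]
  rw [div_le_div_iff₀ (by positivity) hden]
  have key : ((ρ.re - 1) * (ρ.re - 1) + ρ.im * ρ.im) * (1 + ρ.im ^ 2) - ρ.im ^ 2 * (ρ.re * ρ.re + ρ.im * ρ.im)
      = (1 - ρ.re) ^ 2 + 2 * ρ.im ^ 2 * (1 - ρ.re) := by ring
  have hnn : 0 ≤ (1 - ρ.re) ^ 2 + 2 * ρ.im ^ 2 * (1 - ρ.re) := by
    have : 0 ≤ 1 - ρ.re := by linarith
    positivity
  linarith

/-- Height ⟹ modulus: for `0 < Re ρ < 1` and `0 ≤ T ≤ |Im ρ|`, `T/√(1+T²) ≤ |1 − 1/ρ|`. -/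
theorem rate_le_normZ_of_le_abs_im {ρ : ℂ} (h0 : 0 < ρ.re) (h1 : ρ.re < 1) {T : ℝ} (hT : 0 ≤ T)
    (hγ : T ≤ |ρ.im|) : T / Real.sqrt (1 + T ^ 2) ≤ ‖1 - 1 / ρ‖ := by
  have hsq : (T / Real.sqrt (1 + T ^ 2)) ^ 2 ≤ ‖1 - 1 / ρ‖ ^ 2 := by
    rw [div_pow, Real.sq_sqrt (by positivity)]
    refine le_trans ?_ (normZ_sq_ge h0 h1)
    have hγ2 : T ^ 2 ≤ ρ.im ^ 2 := by
      calc T ^ 2 ≤ |ρ.im| ^ 2 := pow_le_pow_left₀ hT hγ 2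
        _ = ρ.im ^ 2 := sq_abs _
    rw [div_le_div_iff₀ (by positivity) (by positivity)]
    nlinarith
  exact (sq_le_sq₀ (div_nonneg hT (Real.sqrt_nonneg _)) (norm_nonneg _)).1 hsq

/-- `T/√(1+T²) ≤ 1`. -/
private theorem rate_le_one (T : ℝ) : T / Real.sqrt (1 + T ^ 2) ≤ 1 := by
  have hpos : 0 < Real.sqrt (1 + T ^ 2) := Real.sqrt_pos.2 (by positivity)
  rw [div_le_one hpos]
  calc T ≤ |T| := le_abs_self T
    _ = Real.sqrt (T ^ 2) := (Real.sqrt_sq_eq_abs T).symm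
    _ ≤ Real.sqrt (1 + T ^ 2) := Real.sqrt_le_sqrt (by linarith)

/-- **Verified height ⟹ least modulus.** `RiemannHypothesisUpTo T` (`T ≥ 0`) ⟹ every non-trivial zero has
`|1 − 1/ρ| ≥ T/√(1+T²)`: on-line zeros have modulus `≥ 1`, off-line ones have `|Im ρ| > T`. -/
theorem rate_le_normZ_of_rhUpTo {T : ℝ} (hT : 0 ≤ T) (hA : RiemannHypothesisUpTo T) {ρ : ℂ}
    (hρ : ρ ∈ ZetaZeros.riemannZetaNontrivialZeros) : T / Real.sqrt (1 + T ^ 2) ≤ ‖1 - 1 / ρ‖ := by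
  rcases le_or_gt ρ.re (1 / 2) with hle | hgt
  · exact (rate_le_one T).trans (one_le_normZ_of_re_le_half hρ hle)
  · have hγ : T < |ρ.im| := by
      refine lt_of_not_ge fun hcon ↦ ?_
      have := re_eq_half_of_abs_im_le hA hρ hcon
      linarith
    exact rate_le_normZ_of_le_abs_im (ZetaZeros.riemannZetaNontrivialZeros.re_pos hρ)
      (ZetaZeros.riemannZetaNontrivialZeros.re_lt_one hρ) hT hγ.le

/-- All moduli `≥ T/√(1+T²)` under `RiemannHypothesisUpTo T`. -/
theorem forall_le_normZ_of_rhUpTo {T : ℝ} (hT : 0 ≤ T) (hA : RiemannHypothesisUpTo T) :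
    ∀ ρ ∈ ZetaZeros.riemannZetaNontrivialZeros, T / Real.sqrt (1 + T ^ 2) ≤ ‖1 - 1 / ρ‖ :=
  fun _ hρ ↦ rate_le_normZ_of_rhUpTo hT hA hρ

/-- `r = 1`: **RH ⟺ every Keiper–Li modulus is `≥ 1`** (⟸: an off-line zero has modulus `< 1`). RH-EQUIVALENCE. -/
theorem rh_iff_forall_one_le_normZ :
    _root_.RiemannHypothesis ↔ ∀ ρ ∈ ZetaZeros.riemannZetaNontrivialZeros, 1 ≤ ‖1 - 1 / ρ‖ := by
  refine ⟨fun h ρ hρ ↦ one_le_normZ_of_rh h hρ, fun h ↦ ?_⟩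
  by_contra hRH
  obtain ⟨ρ, hρ, hre⟩ := exists_offline_zero hRH
  exact absurd (h ρ hρ) (not_le.2 (normZ_lt_one hρ hre))

/-! ## §2 Two analytic lemmas: patching finitely many indices; no room between two rates -/

/-- Patching: an eventual upper bound `x n ≤ C·aⁿ` (`a ≥ 1`, `n ≥ n₁`) holds for ALL `n` after enlarging `C`. -/
theorem patch_upper {x : ℕ → ℝ} {a C : ℝ} (ha : 1 ≤ a) {n₁ : ℕ}
    (h : ∀ n : ℕ, n₁ ≤ n → x n ≤ C * a ^ n) : ∃ C' : ℝ, ∀ n : ℕ, x n ≤ C' * a ^ n := by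
  set H : ℝ := ∑ m ∈ Finset.range n₁, |x m| with hH
  have hH0 : 0 ≤ H := Finset.sum_nonneg fun m _ ↦ abs_nonneg _
  have hM : 0 ≤ max C 0 + H := add_nonneg (le_max_right _ _) hH0
  refine ⟨max C 0 + H, fun n ↦ ?_⟩
  have hpow1 : 1 ≤ a ^ n := one_le_pow₀ ha
  have hpow0 : 0 ≤ a ^ n := zero_le_one.trans hpow1
  by_cases hn : n₁ ≤ n
  · have h1 := h n hn
    have h2 : C * a ^ n ≤ (max C 0 + H) * a ^ n :=
      mul_le_mul_of_nonneg_right (by linarith [le_max_left C 0]) hpow0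
    linarith
  · have hmem : n ∈ Finset.range n₁ := Finset.mem_range.2 (by omega)
    have hle : |x n| ≤ H :=
      Finset.single_le_sum (f := fun m ↦ |x m|) (fun m _ ↦ abs_nonneg _) hmem
    have h3 := le_abs_self (x n)
    have h4 : (max C 0 + H) * 1 ≤ (max C 0 + H) * a ^ n := mul_le_mul_of_nonneg_left hpow1 hM
    linarith [le_max_right C 0]

/-- No room between two rates: if `0 < r₀ < r` and `c > 0` then `C·r^{−n} < c·r₀^{−n}` for all large `n`. -/
theorem eventually_lt_of_rate_gap {r₀ r c : ℝ} (C : ℝ) (hr₀ : 0 < r₀) (hlt : r₀ < r) (hc : 0 < c) :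
    ∃ N₀ : ℕ, ∀ n : ℕ, N₀ ≤ n → C * r⁻¹ ^ n < c * r₀⁻¹ ^ n := by
  have hr : 0 < r := hr₀.trans hlt
  have ha : 1 < r / r₀ := (one_lt_div hr₀).2 hlt
  obtain ⟨N₀, hN₀⟩ :=
    eventually_atTop.1 ((tendsto_pow_atTop_atTop_of_one_lt ha).eventually_gt_atTop (C / c))
  refine ⟨N₀, fun n hn ↦ ?_⟩
  have hgt : C / c < (r / r₀) ^ n := hN₀ n hn
  rw [div_lt_iff₀ hc] at hgt
  have hmul : r / r₀ * r⁻¹ = r₀⁻¹ := by field_simp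
  have hsplit : c * (r / r₀) ^ n * r⁻¹ ^ n = c * r₀⁻¹ ^ n := by rw [mul_assoc, ← mul_pow, hmul]
  have hrpow : 0 < r⁻¹ ^ n := pow_pos (inv_pos.2 hr) n
  have h1 : C < c * (r / r₀) ^ n := by linarith
  calc C * r⁻¹ ^ n < c * (r / r₀) ^ n * r⁻¹ ^ n := mul_lt_mul_of_pos_right h1 hrpow
    _ = c * r₀⁻¹ ^ n := hsplit

/-! ## §3 The two halves of the law -/

/-- **⟹ (both signs at once).** A one-sided envelope `σ·λ_n ≥ −C·r^{−n}` for all `n ≥ 1` (`σ = 1`: floor; `σ = −1`: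
ceiling), `r ≤ 1`, forces every Keiper–Li modulus to be `≥ r`.  Under RH trivially (moduli `≥ 1`); under `¬RH` the
least modulus `r₀` carries, by `li_two_signs_of_not_rh`, values `λ_n ≤ −c·r₀^{−n}` AND `λ_n ≥ c·r₀^{−n}` in every window —
incompatible with an envelope at any slower rate `r^{−n}`, `r > r₀` (`eventually_lt_of_rate_gap`). RH-FREE. -/
theorem forall_le_normZ_of_oneSided {σ : ℝ} (hσ : σ = 1 ∨ σ = -1) {r : ℝ} (hr1 : r ≤ 1)
    {C : ℝ} (hC : ∀ n : ℕ, 1 ≤ n → -(C * r⁻¹ ^ n) ≤ σ * keiperLiCoeff n) :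
    ∀ ρ ∈ ZetaZeros.riemannZetaNontrivialZeros, r ≤ ‖1 - 1 / ρ‖ := by
  by_cases hRH : _root_.RiemannHypothesis
  · exact fun ρ hρ ↦ hr1.trans (one_le_normZ_of_rh hRH hρ)
  obtain ⟨r₀, hr₀0, -, hglob, -, c, hc, -, L, n₁, -, hwin⟩ := li_two_signs_of_not_rh hRH
  suffices hrr : r ≤ r₀ from fun ρ hρ ↦ hrr.trans (hglob ρ hρ)
  by_contra hlt
  rw [not_le] at hlt
  obtain ⟨N₀, hN₀⟩ := eventually_lt_of_rate_gap C hr₀0 hlt hc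
  obtain ⟨⟨n, hn, hposv⟩, ⟨n', hn', hnegv⟩⟩ := hwin (N₀ + n₁ + 1) (by omega)
  rcases hσ with rfl | rfl
  · have h1 := (Finset.mem_Ico.1 hn').1
    have hf := hC n' (by omega)
    have hg := hN₀ n' (by omega)
    rw [one_mul] at hf
    linarith
  · have h1 := (Finset.mem_Ico.1 hn).1
    have hf := hC n (by omega)
    have hg := hN₀ n (by omega)
    rw [neg_one_mul] at hf
    linarith

/-- **⟸ under `¬RH`.** If every modulus is `≥ r > 0` then `|λ_n| ≤ C·r^{−n}` for all `n` (the least modulus `r₀ ≥ r`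
carries the envelope `|λ_n| ≤ C·r₀^{−n}` of `li_two_signs_of_not_rh`; patch the finitely many small `n`). RH-FREE. -/
theorem liEnvelope_of_forall_le_normZ_of_not_rh (hRH : ¬ _root_.RiemannHypothesis) {r : ℝ} (hr0 : 0 < r)
    (hz : ∀ ρ ∈ ZetaZeros.riemannZetaNontrivialZeros, r ≤ ‖1 - 1 / ρ‖) :
    ∃ C : ℝ, ∀ n : ℕ, |keiperLiCoeff n| ≤ C * r⁻¹ ^ n := by
  obtain ⟨r₀, hr₀0, hr₀1, -, ⟨ρ₀, hρ₀, hEq⟩, c, -, C, L, n₁, habs, -⟩ := li_two_signs_of_not_rh hRH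
  have hrr : r ≤ r₀ := (hz ρ₀ hρ₀).trans_eq hEq
  have ha : 1 ≤ r⁻¹ := (one_le_inv_iff₀).2 ⟨hr0, hrr.trans hr₀1.le⟩
  have hev : ∀ n : ℕ, n₁ ≤ n → |keiperLiCoeff n| ≤ max C 0 * r⁻¹ ^ n := by
    intro n hn
    have h2 : r₀⁻¹ ^ n ≤ r⁻¹ ^ n := pow_le_pow_left₀ (inv_pos.2 hr₀0).le (inv_anti₀ hr0 hrr) n
    calc |keiperLiCoeff n| ≤ C * r₀⁻¹ ^ n := habs n hn
      _ ≤ max C 0 * r₀⁻¹ ^ n := mul_le_mul_of_nonneg_right (le_max_left _ _) (pow_nonneg (inv_pos.2 hr₀0).le n)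
      _ ≤ max C 0 * r⁻¹ ^ n := mul_le_mul_of_nonneg_left h2 (le_max_right _ _)
  exact patch_upper ha hev

/-- **RH ⟹ ceiling at every rate `r < 1`** (the tree's `liSubexpUpper_of_rh` with `ε = log r⁻¹`, patched to all `n`). RH-FREE implication. -/
theorem liCeilRate_of_rh (hRH : _root_.RiemannHypothesis) {r : ℝ} (hr0 : 0 < r) (hr1 : r < 1) :
    ∃ C : ℝ, ∀ n : ℕ, keiperLiCoeff n ≤ C * r⁻¹ ^ n := by
  have h1 : 1 < r⁻¹ := (one_lt_inv_iff₀).2 ⟨hr0, hr1⟩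
  have hε : 0 < Real.log r⁻¹ := Real.log_pos h1
  obtain ⟨C, n₀, hn₀⟩ := liSubexpUpper_of_rh hRH (Real.log r⁻¹) hε
  have hev : ∀ n : ℕ, n₀ ≤ n → keiperLiCoeff n ≤ C * r⁻¹ ^ n := by
    intro n hn
    have h := hn₀ n hn
    rwa [mul_comm (Real.log r⁻¹), Real.exp_nat_mul, Real.exp_log (inv_pos.2 hr0)] at h
  exact patch_upper h1.le hev

/-! ## §4 THE FLOOR-RATE LAW and its ceiling / two-sided forms (RH-FREE equivalences) -/

/-- **FLOOR-RATE LAW.** For `0 < r ≤ 1`: `(∃ C, ∀ n ≥ 1, λ_n ≥ −C·r^{−n}) ⟺ (∀ ρ, |1 − 1/ρ| ≥ r)` — a floor at a fixed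
exponential rate is EXACTLY the statement that `ζ` has no zero in the Apollonius disc `{|s−1| < r|s|}`.  At `r = 1` both
sides are RH (`liFloorRate_one_iff_rh`); for `r < 1` both are implied by `RiemannHypothesisUpTo (r/√(1−r²))`. RH-FREE EQUIVALENCE. -/
theorem liFloorRate_iff {r : ℝ} (hr0 : 0 < r) (hr1 : r ≤ 1) :
    (∃ C : ℝ, ∀ n : ℕ, 1 ≤ n → -(C * r⁻¹ ^ n) ≤ keiperLiCoeff n) ↔
      ∀ ρ ∈ ZetaZeros.riemannZetaNontrivialZeros, r ≤ ‖1 - 1 / ρ‖ := by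
  constructor
  · rintro ⟨C, hC⟩
    exact forall_le_normZ_of_oneSided (σ := 1) (Or.inl rfl) hr1 (C := C) fun n hn ↦ by
      rw [one_mul]; exact hC n hn
  · intro hz
    by_cases hRH : _root_.RiemannHypothesis
    · exact ⟨0, fun n hn ↦ by rw [zero_mul, neg_zero]; exact (li_criterion_holds.1 hRH) n hn⟩
    · obtain ⟨C, hC⟩ := liEnvelope_of_forall_le_normZ_of_not_rh hRH hr0 hz
      exact ⟨C, fun n _ ↦ (abs_le.1 (hC n)).1⟩

/-- **CEILING-RATE LAW.** For `0 < r < 1`: `(∃ C, ∀ n ≥ 1, λ_n ≤ C·r^{−n}) ⟺ (∀ ρ, |1 − 1/ρ| ≥ r)`.  (At `r = 1` the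
ceiling side is FALSE outright — `λ_n` is unbounded above unconditionally, `li_unbounded_above` — while the zero side is RH.)
RH-FREE EQUIVALENCE. -/
theorem liCeilRate_iff {r : ℝ} (hr0 : 0 < r) (hr1 : r < 1) :
    (∃ C : ℝ, ∀ n : ℕ, 1 ≤ n → keiperLiCoeff n ≤ C * r⁻¹ ^ n) ↔
      ∀ ρ ∈ ZetaZeros.riemannZetaNontrivialZeros, r ≤ ‖1 - 1 / ρ‖ := by
  constructor
  · rintro ⟨C, hC⟩
    exact forall_le_normZ_of_oneSided (σ := -1) (Or.inr rfl) hr1.le (C := C) fun n hn ↦ by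
      rw [neg_one_mul, neg_le_neg_iff]; exact hC n hn
  · intro hz
    by_cases hRH : _root_.RiemannHypothesis
    · obtain ⟨C, hC⟩ := liCeilRate_of_rh hRH hr0 hr1
      exact ⟨C, fun n _ ↦ hC n⟩
    · obtain ⟨C, hC⟩ := liEnvelope_of_forall_le_normZ_of_not_rh hRH hr0 hz
      exact ⟨C, fun n _ ↦ (abs_le.1 (hC n)).2⟩

/-- **TWO-SIDED ENVELOPE LAW.** For `0 < r < 1`: `(∃ C, ∀ n ≥ 1, |λ_n| ≤ C·r^{−n}) ⟺ (∀ ρ, |1 − 1/ρ| ≥ r)` — the exact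
rate, no `ε` (Cauchy–Hadamard only gives `limsup |λ_n|^{1/n} = 1/min|1 − 1/ρ|`). RH-FREE EQUIVALENCE. -/
theorem liEnvelopeRate_iff {r : ℝ} (hr0 : 0 < r) (hr1 : r < 1) :
    (∃ C : ℝ, ∀ n : ℕ, 1 ≤ n → |keiperLiCoeff n| ≤ C * r⁻¹ ^ n) ↔
      ∀ ρ ∈ ZetaZeros.riemannZetaNontrivialZeros, r ≤ ‖1 - 1 / ρ‖ := by
  constructor
  · rintro ⟨C, hC⟩
    exact (liFloorRate_iff hr0 hr1.le).1 ⟨C, fun n hn ↦ (abs_le.1 (hC n hn)).1⟩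
  · intro hz
    obtain ⟨C₁, hC₁⟩ := (liFloorRate_iff hr0 hr1.le).2 hz
    obtain ⟨C₂, hC₂⟩ := (liCeilRate_iff hr0 hr1).2 hz
    have hp : ∀ n : ℕ, 0 ≤ r⁻¹ ^ n := fun n ↦ pow_nonneg (inv_pos.2 hr0).le n
    refine ⟨max C₁ C₂, fun n hn ↦ abs_le.2 ⟨?_, ?_⟩⟩
    · have h1 := hC₁ n hn
      have h2 : C₁ * r⁻¹ ^ n ≤ max C₁ C₂ * r⁻¹ ^ n := mul_le_mul_of_nonneg_right (le_max_left _ _) (hp n)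
      linarith
    · have h1 := hC₂ n hn
      have h2 : C₂ * r⁻¹ ^ n ≤ max C₁ C₂ * r⁻¹ ^ n := mul_le_mul_of_nonneg_right (le_max_right _ _) (hp n)
      linarith

end Summit.RiemannHypothesis.RiemannHypothesis.Theorems.Splittings.LiFloorRateLaw

end
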